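import Mathlib

/-!
# `DivisionGap.PerMultiplesHard` (stmt-ValiantsHypothesis-5068), line `uncharged-face-walk`:
the RICH PIECE, part 1 — arithmetic of the richness potential (lead c9, cycle 9)

The lead's extremal argument (part 2, `stub_richPiece`) maximises the potential
`Φ(c, m) := (log m − log c!)/c + (1/(32K))·log c` (`c` = size of a σ₀-square sub-board, `m` = its number of
perfect matchings) and needs three facts of real arithmetic, proved here with all objects natural numbers:
* `phi_lt_of_removal`: removing a row of degree `d < c/(4K)` (which divides the matching count by at most `d`)
  strictly INCREASES `Φ` as soon as the board is `K`-rich (`(log m − log c!)/c ≥ −log K`);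
* `split_absurd`: a near-tight split `m ≤ C(ν, u)·m₁·m₂` with `ν ≤ u + s − 1`, `s = c/(2048K²) + 1`, both parts of
  size `≥ c/(4K)`-ish, contradicts maximality of `Φ` at `(c, m)` — the gain `log C(c,u) ≥ min(u,c−u)·log 2`
  (central binomial coefficient) beats the cost `log C(u+s−1, u) ≤ (c/2048K²)(log(4096K²)+1)` (Stirling) plus
  the entropy term `μ·(c log c − u log u − (c−u)log(c−u)) ≤ μc`;
* small lemmas on binomials feeding them.
Elementary real analysis over Mathlib (`Stirling.le_log_factorial_stirling`, `Nat.choose_le_pow_div`,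
`Nat.four_pow_le_two_mul_self_mul_centralBinom`; the one-line facts `log x − log(x−1) ≤ 1/(x−1)` and `t log t − t ≤ log t!` are
inlined where used — they exist in unrelated Literature modules the file does not import). [folklore]
-/

noncomputable section

-- `Summit.ValiantsHypothesis.ValiantsHypothesis.…` is the tree's mandated layout (Sub = Summit).
set_option linter.dupNamespace false

open Finset Real
open scoped BigOperators

namespace Summit.ValiantsHypothesis.ValiantsHypothesis.Theorems.DivisionGap.PerMultiplesHard.RichPieceArith

/-! ### Logarithms of binomials and factorials -/

/-- The crude entropy bound `c·log c − u·log u − (c−u)·log(c−u) ≤ c` for `0 < u < c`. -/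
theorem entropy_crude {u c : ℝ} (hu : 0 < u) (huc : u < c) :
    c * Real.log c - u * Real.log u - (c - u) * Real.log (c - u) ≤ c := by
  have hc : 0 < c := hu.trans huc
  have hcu : 0 < c - u := by linarith
  have h1 := Real.log_le_sub_one_of_pos (show 0 < c / u by positivity)
  have h2 := Real.log_le_sub_one_of_pos (show 0 < c / (c - u) by positivity)
  rw [Real.log_div hc.ne' hu.ne'] at h1
  rw [Real.log_div hc.ne' hcu.ne'] at h2
  have e1 : u * (Real.log c - Real.log u) ≤ u * (c / u - 1) := mul_le_mul_of_nonneg_left h1 hu.le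
  have e2 : (c - u) * (Real.log c - Real.log (c - u)) ≤ (c - u) * (c / (c - u) - 1) :=
    mul_le_mul_of_nonneg_left h2 hcu.le
  have e3 : u * (c / u - 1) = c - u := by field_simp
  have e4 : (c - u) * (c / (c - u) - 1) = u := by field_simp; ring
  nlinarith [e1, e2, e3, e4]

/-- `k·log 2 ≤ log C(2k, k)`: from `4^k ≤ 2k·C(2k,k)` and `2k ≤ 2^k`. -/
theorem mul_log_two_le_log_centralBinom (k : ℕ) (hk : 1 ≤ k) :
    (k : ℝ) * Real.log 2 ≤ Real.log ((2 * k).choose k : ℕ) := by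
  have h4 : 4 ^ k ≤ 2 * k * Nat.centralBinom k := Nat.four_pow_le_two_mul_self_mul_centralBinom k hk
  rw [Nat.centralBinom_eq_two_mul_choose] at h4
  have h2k : 2 * k ≤ 2 ^ k := by
    have := Nat.lt_two_pow_self (n := k - 1)
    have hk' : k = (k - 1) + 1 := by omega
    calc 2 * k = 2 * ((k - 1) + 1) := by rw [← hk']
      _ ≤ 2 * 2 ^ (k - 1) := by omega
      _ = 2 ^ k := by rw [← pow_succ']; congr 1; omega
  have hpos : 0 < ((2 * k).choose k : ℕ) := Nat.choose_pos (by omega)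
  -- in reals: 4^k ≤ 2k · C ≤ 2^k · C, so 2^k ≤ C
  have hR : (4 : ℝ) ^ k ≤ (2 : ℝ) ^ k * ((2 * k).choose k : ℕ) := by
    have h4R : ((4 ^ k : ℕ) : ℝ) ≤ ((2 * k * (2 * k).choose k : ℕ) : ℝ) := by exact_mod_cast h4
    have h2R : ((2 * k : ℕ) : ℝ) ≤ ((2 ^ k : ℕ) : ℝ) := by exact_mod_cast h2k
    push_cast at h4R h2R
    calc (4 : ℝ) ^ k ≤ 2 * k * ((2 * k).choose k : ℕ) := h4R
      _ ≤ (2 : ℝ) ^ k * ((2 * k).choose k : ℕ) := by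
          apply mul_le_mul_of_nonneg_right h2R; positivity
  have h22 : (4 : ℝ) ^ k = (2 : ℝ) ^ k * (2 : ℝ) ^ k := by
    rw [← mul_pow]; norm_num
  rw [h22] at hR
  have hC : (2 : ℝ) ^ k ≤ ((2 * k).choose k : ℕ) := le_of_mul_le_mul_left hR (by positivity)
  calc (k : ℝ) * Real.log 2 = Real.log ((2 : ℝ) ^ k) := by rw [Real.log_pow]
    _ ≤ Real.log ((2 * k).choose k : ℕ) := Real.log_le_log (by positivity) hC

/-- `min(u, c−u)·log 2 ≤ log C(c, u)` for `u ≤ c` (monotonicity of `C(·, k)` down to the central coefficient). -/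
theorem min_mul_log_two_le_log_choose (c u : ℕ) (huc : u ≤ c) (hk : 1 ≤ min u (c - u)) :
    (min u (c - u) : ℕ) * Real.log 2 ≤ Real.log (c.choose u : ℕ) := by
  have hmain : (2 * min u (c - u)).choose (min u (c - u)) ≤ c.choose u := by
    rcases le_total u (c - u) with h | h
    · rw [min_eq_left h]
      exact Nat.choose_le_choose u (by omega)
    · rw [min_eq_right h]
      have : c.choose u = c.choose (c - u) := (Nat.choose_symm huc).symm
      rw [this]
      exact Nat.choose_le_choose (c - u) (by omega)
  have hpos : 0 < (2 * min u (c - u)).choose (min u (c - u)) := Nat.choose_pos (by omega)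
  calc (min u (c - u) : ℕ) * Real.log 2 ≤ Real.log ((2 * min u (c - u)).choose (min u (c - u)) : ℕ) :=
        mul_log_two_le_log_centralBinom _ hk
    _ ≤ Real.log (c.choose u : ℕ) := Real.log_le_log (by exact_mod_cast hpos) (by exact_mod_cast hmain)

/-- The cost of a near-tight split: `log C(u + t, t) ≤ t·(log((u+t)/t) + 1)` for `t ≥ 1`
(`C(N, t) ≤ N^t/t!` and `t! ≥ (t/e)^t`). -/
theorem log_choose_add_le (u t : ℕ) (ht : 1 ≤ t) :
    Real.log ((u + t).choose t : ℕ) ≤ t * (Real.log (((u + t : ℕ) : ℝ) / t) + 1) := by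
  have htR : (0 : ℝ) < t := by exact_mod_cast ht
  have hN : (0 : ℝ) < ((u + t : ℕ) : ℝ) := by exact_mod_cast (show 0 < u + t by omega)
  have h1 : (((u + t).choose t : ℕ) : ℝ) ≤ ((u + t : ℕ) : ℝ) ^ t / (t.factorial : ℕ) := by
    have := Nat.choose_le_pow_div (α := ℝ) t (u + t)
    exact_mod_cast this
  have hpos : (0 : ℝ) < ((u + t).choose t : ℕ) := by exact_mod_cast Nat.choose_pos (by omega)
  have hfpos : (0 : ℝ) < (t.factorial : ℕ) := by exact_mod_cast Nat.factorial_pos t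
  have h2 : Real.log ((u + t).choose t : ℕ) ≤ t * Real.log ((u + t : ℕ) : ℝ) - Real.log (t.factorial : ℕ) := by
    calc Real.log ((u + t).choose t : ℕ) ≤ Real.log (((u + t : ℕ) : ℝ) ^ t / (t.factorial : ℕ)) :=
          Real.log_le_log hpos h1
      _ = t * Real.log ((u + t : ℕ) : ℝ) - Real.log (t.factorial : ℕ) := by
          rw [Real.log_div (by positivity) hfpos.ne', Real.log_pow]
  -- Stirling, crude form: `t·log t − t ≤ log t!`
  have h3 : (t : ℝ) * Real.log t - t ≤ Real.log (t.factorial : ℕ) := by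
    have h := Stirling.le_log_factorial_stirling (n := t) (by omega)
    have h1' : 0 ≤ Real.log t / 2 := by
      have : (1 : ℝ) ≤ t := by exact_mod_cast ht
      have := Real.log_nonneg this; linarith
    have h2' : 0 ≤ Real.log (2 * Real.pi) / 2 := by
      have : (1 : ℝ) ≤ 2 * Real.pi := by have := Real.pi_gt_three; linarith
      have := Real.log_nonneg this; linarith
    linarith
  rw [Real.log_div hN.ne' htR.ne']
  nlinarith [h2, h3]

/-! ### The two potential inequalities -/

/-- **Removal raises the potential.**  `Φ(c, m) := (log m − log c!)/c + μ log c` with `μ = 1/(32K)`: if `c ≥ 2`, `1 ≤ m`,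
`m ≤ d·m'` with `1 ≤ d` and `4K·d < c`, and the board is `K`-rich, then `Φ(c, m) < Φ(c − 1, m')`. -/
theorem phi_lt_of_removal (K c d m m' : ℕ) (hK : 1 ≤ K) (hc : 2 ≤ c) (hm : 1 ≤ m) (hm' : 1 ≤ m') (hd : 1 ≤ d)
    (hmd : m ≤ d * m') (hdc : 4 * K * d < c)
    (hrich : -Real.log K ≤ (Real.log m - Real.log (c.factorial : ℕ)) / c) :
    (Real.log m - Real.log (c.factorial : ℕ)) / c + 1 / (32 * (K : ℝ)) * Real.log c <
      (Real.log m' - Real.log ((c - 1).factorial : ℕ)) / ((c - 1 : ℕ) : ℝ) +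
        1 / (32 * (K : ℝ)) * Real.log ((c - 1 : ℕ) : ℝ) := by
  have hKR : (1 : ℝ) ≤ K := by exact_mod_cast hK
  have hcR : (2 : ℝ) ≤ c := by exact_mod_cast hc
  have hc1 : ((c - 1 : ℕ) : ℝ) = (c : ℝ) - 1 := by
    rw [Nat.cast_sub (by omega)]; simp
  rw [hc1]
  set L := Real.log m - Real.log (c.factorial : ℕ) with hL
  set μ := 1 / (32 * (K : ℝ)) with hμ
  have hμ1 : μ ≤ 1 / 32 := by
    rw [hμ]; apply div_le_div_of_nonneg_left (by norm_num) (by norm_num)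
    linarith
  have hμ0 : 0 ≤ μ := by rw [hμ]; positivity
  -- log c! = log c + log (c-1)!
  have hfac : Real.log (c.factorial : ℕ) = Real.log c + Real.log ((c - 1).factorial : ℕ) := by
    have : c.factorial = c * (c - 1).factorial := by
      conv_lhs => rw [show c = (c - 1) + 1 by omega, Nat.factorial_succ]
      congr 1; omega
    rw [this, Nat.cast_mul, Real.log_mul (by positivity) (by positivity)]
  -- log m' ≥ log m − log d
  have hlogm' : Real.log m - Real.log d ≤ Real.log m' := by
    have h1 : (m : ℝ) ≤ (d : ℝ) * m' := by exact_mod_cast hmd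
    have h2 : Real.log m ≤ Real.log ((d : ℝ) * m') :=
      Real.log_le_log (by exact_mod_cast hm) h1
    rw [Real.log_mul (by positivity) (by positivity)] at h2
    linarith
  -- A := log c − log d > log 4
  have hA : Real.log 4 < Real.log c - Real.log d - Real.log K := by
    have h1 : (4 : ℝ) * K * d < c := by exact_mod_cast hdc
    have h2 : Real.log ((4 : ℝ) * K * d) < Real.log c := Real.log_lt_log (by positivity) h1
    rw [Real.log_mul (by positivity) (by positivity), Real.log_mul (by positivity) (by positivity)] at h2
    linarith
  have hlog4 : (1 : ℝ) < Real.log 4 := by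
    have : Real.log 4 = 2 * Real.log 2 := by
      rw [show (4 : ℝ) = 2 ^ 2 by norm_num, Real.log_pow]; norm_num
    rw [this]; have := Real.log_two_gt_d9; linarith
  have hx1 : (0 : ℝ) < (c : ℝ) - 1 := by linarith
  have hx0 : (0 : ℝ) < (c : ℝ) := by linarith
  -- RHS ≥ (L + log c − log d)/(c−1) + μ log (c−1)
  have hR : (L + Real.log c - Real.log d) / ((c : ℝ) - 1) ≤
      (Real.log m' - Real.log ((c - 1).factorial : ℕ)) / ((c : ℝ) - 1) := by
    apply div_le_div_of_nonneg_right _ hx1.le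
    rw [hL, hfac]; linarith
  -- `log c − log(c−1) ≤ 1/(c−1)` (from `log y ≤ y − 1`)
  have hlogc : Real.log c - Real.log ((c : ℝ) - 1) ≤ 1 / ((c : ℝ) - 1) := by
    have h := Real.log_le_sub_one_of_pos (show 0 < (c : ℝ) / ((c : ℝ) - 1) by positivity)
    rw [Real.log_div hx0.ne' hx1.ne'] at h
    have e : (c : ℝ) / ((c : ℝ) - 1) - 1 = 1 / ((c : ℝ) - 1) := by field_simp; ring
    linarith
  -- it suffices: L/c + μ (log c − log(c−1)) < (L + log c − log d)/(c−1)
  have hLc : -Real.log K ≤ L / c := hrich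
  have key : L / c + μ * (1 / ((c : ℝ) - 1)) < (L + Real.log c - Real.log d) / ((c : ℝ) - 1) := by
    rw [lt_div_iff₀ hx1]
    have e : (L / c + μ * (1 / ((c : ℝ) - 1))) * ((c : ℝ) - 1) = L - L / c + μ := by
      field_simp
    rw [e]
    linarith [hLc, hA, hlog4, hμ1]
  have hμmono : μ * (Real.log c - Real.log ((c : ℝ) - 1)) ≤ μ * (1 / ((c : ℝ) - 1)) :=
    mul_le_mul_of_nonneg_left hlogc hμ0
  nlinarith [key, hR, hμmono]

/-- **A near-tight split contradicts maximality of the potential.**  With `μ = 1/(32K)`, `s = c/(2048K²) + 1`: if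
`1 ≤ u`, `u + s ≤ c`, the split bound `m ≤ C(ν, u)·m₁·m₂` holds with `ν + 1 ≤ u + s`, `c ≤ 4K·ν`,
`c ≤ 4K·(c − u)`, and both parts have potential at most that of `(c, m)`, then `False`. -/
theorem split_absurd :
    ∀ (K c u ν s m m₁ m₂ : ℕ), 1 ≤ K → 1 ≤ u → s = c / (2048 * K ^ 2) + 1 → u + s ≤ c → ν + 1 ≤ u + s →
      c ≤ 4 * K * ν → c ≤ 4 * K * (c - u) → 1 ≤ m → 1 ≤ m₁ → 1 ≤ m₂ → m ≤ ν.choose u * (m₁ * m₂) →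
      (Real.log m₁ - Real.log (u.factorial : ℕ)) / u + 1 / (32 * (K : ℝ)) * Real.log u ≤
        (Real.log m - Real.log (c.factorial : ℕ)) / c + 1 / (32 * (K : ℝ)) * Real.log c →
      (Real.log m₂ - Real.log ((c - u).factorial : ℕ)) / ((c - u : ℕ) : ℝ) +
          1 / (32 * (K : ℝ)) * Real.log ((c - u : ℕ) : ℝ) ≤
        (Real.log m - Real.log (c.factorial : ℕ)) / c + 1 / (32 * (K : ℝ)) * Real.log c →
      False := by
  intro K c u ν s m m₁ m₂ hK hu hs hus hν hνdeg hcu hm hm₁ hm₂ hsplit hmax₁ hmax₂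
  have hKR : (1 : ℝ) ≤ K := by exact_mod_cast hK
  have hs1 : 1 ≤ s := by rw [hs]; exact Nat.le_add_left 1 _
  have huc : u < c := by omega
  have huR : (1 : ℝ) ≤ u := by exact_mod_cast hu
  have hcuN : 1 ≤ c - u := by omega
  have hcuR : ((c - u : ℕ) : ℝ) = (c : ℝ) - u := by rw [Nat.cast_sub huc.le]
  have hcR : (0 : ℝ) < c := by exact_mod_cast (show 0 < c by omega)
  have hcu0 : (0 : ℝ) < (c : ℝ) - u := by
    have : (1 : ℝ) ≤ (c : ℝ) - u := by rw [← hcuR]; exact_mod_cast hcuN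
    linarith
  set μ := 1 / (32 * (K : ℝ)) with hμ
  set L := Real.log m - Real.log (c.factorial : ℕ) with hL
  have hμ0 : 0 < μ := by rw [hμ]; positivity
  -- (1) the factorial identity: log c! = log C(c,u) + log u! + log (c−u)!
  have hfact : Real.log (c.factorial : ℕ) =
      Real.log (c.choose u : ℕ) + Real.log (u.factorial : ℕ) + Real.log ((c - u).factorial : ℕ) := by
    have h := Nat.choose_mul_factorial_mul_factorial huc.le
    have hR : ((c.factorial : ℕ) : ℝ) =
        ((c.choose u : ℕ) : ℝ) * ((u.factorial : ℕ) : ℝ) * (((c - u).factorial : ℕ) : ℝ) := by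
      exact_mod_cast h.symm
    have hch : (0 : ℝ) < ((c.choose u : ℕ) : ℝ) := by exact_mod_cast Nat.choose_pos huc.le
    have hf1 : (0 : ℝ) < ((u.factorial : ℕ) : ℝ) := by exact_mod_cast Nat.factorial_pos u
    have hf2 : (0 : ℝ) < (((c - u).factorial : ℕ) : ℝ) := by exact_mod_cast Nat.factorial_pos (c - u)
    rw [hR, Real.log_mul (mul_pos hch hf1).ne' hf2.ne', Real.log_mul hch.ne' hf1.ne']
  -- (2) the split bound in logs: log m ≤ log C(ν,u) + log m₁ + log m₂
  have hsplitR : Real.log m ≤ Real.log (ν.choose u : ℕ) + Real.log m₁ + Real.log m₂ := by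
    have hpos : 0 < ν.choose u := by
      rcases Nat.eq_zero_or_pos (ν.choose u) with h0 | h0
      · rw [h0] at hsplit; omega
      · exact h0
    have h1 : (m : ℝ) ≤ ((ν.choose u : ℕ) : ℝ) * ((m₁ : ℝ) * m₂) := by exact_mod_cast hsplit
    have h2 := Real.log_le_log (by exact_mod_cast hm) h1
    rw [Real.log_mul (by positivity) (by positivity), Real.log_mul (by positivity) (by positivity)] at h2
    linarith only [h2]
  -- (3) cost: log C(ν,u) ≤ (c/(2048K²))·(log(4096K²) + 1)
  set t := c / (2048 * K ^ 2) with ht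
  have hνle : ν.choose u ≤ (u + t).choose u := Nat.choose_le_choose u (by omega)
  have hsymm : (u + t).choose u = (u + t).choose t := by
    rw [Nat.choose_symm_add]
  have hcost : Real.log (ν.choose u : ℕ) ≤ (c : ℝ) / (2048 * (K : ℝ) ^ 2) * (Real.log (4096 * (K : ℝ) ^ 2) + 1) := by
    have hνpos : 0 < ν.choose u := by
      rcases Nat.eq_zero_or_pos (ν.choose u) with h0 | h0
      · rw [h0] at hsplit; omega
      · exact h0
    have step1 : Real.log (ν.choose u : ℕ) ≤ Real.log ((u + t).choose t : ℕ) := by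
      rw [← hsymm]; exact Real.log_le_log (by exact_mod_cast hνpos) (by exact_mod_cast hνle)
    rcases Nat.eq_zero_or_pos t with ht0 | htpos
    · -- t = 0: the cost vanishes
      have : (u + t).choose t = 1 := by rw [ht0]; simp
      rw [this] at step1
      simp only [Nat.cast_one, Real.log_one] at step1
      have : (0 : ℝ) ≤ (c : ℝ) / (2048 * (K : ℝ) ^ 2) * (Real.log (4096 * (K : ℝ) ^ 2) + 1) := by
        apply mul_nonneg (by positivity)
        have h1' : (1 : ℝ) ≤ 4096 * (K : ℝ) ^ 2 := by nlinarith only [hKR]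
        have := Real.log_nonneg h1'; linarith only [this]
      linarith only [step1, this]
    · have step2 := log_choose_add_le u t htpos
      -- t ≤ c/(2048K²) and (u+t)/t ≤ c/t < 4096K²
      have htR : (t : ℝ) ≤ (c : ℝ) / (2048 * (K : ℝ) ^ 2) := by
        rw [le_div_iff₀ (by positivity)]
        have : t * (2048 * K ^ 2) ≤ c := by rw [ht]; exact Nat.div_mul_le_self c _
        exact_mod_cast this
      have htpos' : (0 : ℝ) < t := by exact_mod_cast htpos
      have hct : (c : ℝ) < 4096 * (K : ℝ) ^ 2 * t := by
        -- c < 2048K²·(t+1) ≤ 4096K²·t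
        have h1 : c < 2048 * K ^ 2 * (t + 1) := by
          rw [ht]; exact Nat.lt_mul_div_succ c (by positivity)
        have h2 : 2048 * K ^ 2 * (t + 1) ≤ 4096 * K ^ 2 * t := by nlinarith only [htpos]
        exact_mod_cast (lt_of_lt_of_le h1 h2)
      have hut : ((u + t : ℕ) : ℝ) ≤ c := by exact_mod_cast (show u + t ≤ c by omega)
      have hratio : Real.log (((u + t : ℕ) : ℝ) / t) ≤ Real.log (4096 * (K : ℝ) ^ 2) := by
        apply Real.log_le_log (by positivity)
        rw [div_le_iff₀ htpos']; linarith only [hut, hct]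
      have hlogpos : 0 ≤ Real.log (4096 * (K : ℝ) ^ 2) + 1 := by
        have h1' : (1 : ℝ) ≤ 4096 * (K : ℝ) ^ 2 := by nlinarith only [hKR]
        have := Real.log_nonneg h1'; linarith only [this]
      calc Real.log (ν.choose u : ℕ) ≤ t * (Real.log (((u + t : ℕ) : ℝ) / t) + 1) := step1.trans step2
        _ ≤ t * (Real.log (4096 * (K : ℝ) ^ 2) + 1) := by
            apply mul_le_mul_of_nonneg_left _ htpos'.le; linarith only [hratio]
        _ ≤ (c : ℝ) / (2048 * (K : ℝ) ^ 2) * (Real.log (4096 * (K : ℝ) ^ 2) + 1) :=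
            mul_le_mul_of_nonneg_right htR hlogpos
  -- (4) gain: log C(c,u) ≥ (c/(8K))·log 2
  have hgain : (c : ℝ) / (8 * K) * Real.log 2 ≤ Real.log (c.choose u : ℕ) := by
    have hk1 : 1 ≤ min u (c - u) := le_min hu hcuN
    have h1 := min_mul_log_two_le_log_choose c u huc.le hk1
    have hkR : (c : ℝ) / (8 * K) ≤ ((min u (c - u) : ℕ) : ℝ) := by
      rw [div_le_iff₀ (by positivity)]
      rcases le_total u (c - u) with h | h
      · rw [min_eq_left h]
        -- u ≥ ν + 1 − s ≥ c/(4K) − c/(2048K²) ≥ c/(8K)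
        have hνR : (c : ℝ) ≤ 4 * K * ν := by exact_mod_cast hνdeg
        have hsR : ((s : ℕ) : ℝ) ≤ (c : ℝ) / (2048 * (K : ℝ) ^ 2) + 1 := by
          have e : ((s : ℕ) : ℝ) = ((c / (2048 * K ^ 2) : ℕ) : ℝ) + 1 := by rw [hs]; push_cast; ring
          rw [e]
          have hdiv := Nat.cast_div_le (m := c) (n := 2048 * K ^ 2) (α := ℝ)
          push_cast at hdiv; linarith only [hdiv]
        have huν : (ν : ℝ) + 1 ≤ u + s := by exact_mod_cast hν
        have hx : (8 * (K : ℝ)) * ((c : ℝ) / (2048 * (K : ℝ) ^ 2)) = (c : ℝ) / (256 * K) := by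
          field_simp; ring
        have hx2 : (c : ℝ) / (256 * K) ≤ c := by
          apply div_le_self hcR.le; linarith only [hKR]
        have h1 : (u : ℝ) ≥ ν - (c : ℝ) / (2048 * (K : ℝ) ^ 2) := by linarith only [hsR, huν]
        have h2 : (u : ℝ) * (8 * K) ≥ (ν - (c : ℝ) / (2048 * (K : ℝ) ^ 2)) * (8 * K) :=
          mul_le_mul_of_nonneg_right h1 (by positivity)
        have h3 : (ν - (c : ℝ) / (2048 * (K : ℝ) ^ 2)) * (8 * K) = 8 * K * ν - (c : ℝ) / (256 * K) := by
          rw [sub_mul, mul_comm ((c : ℝ) / _) _, hx]; ring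
        linarith only [h2, h3, hνR, hx2]
      · rw [min_eq_right h, hcuR]
        have h' : (c : ℝ) ≤ 4 * K * ((c : ℝ) - u) := by
          have h'' : (c : ℝ) ≤ 4 * K * ((c - u : ℕ) : ℝ) := by exact_mod_cast hcu
          rwa [hcuR] at h''
        nlinarith only [h', hKR, hcu0]
    have hl2 : 0 < Real.log 2 := Real.log_pos (by norm_num)
    calc (c : ℝ) / (8 * K) * Real.log 2 ≤ ((min u (c - u) : ℕ) : ℝ) * Real.log 2 :=
          mul_le_mul_of_nonneg_right hkR hl2.le
      _ ≤ Real.log (c.choose u : ℕ) := h1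
  -- (5) maximality summed with weights u, c−u:
  --     log C(c,u) − log C(ν,u) ≤ μ (c log c − u log u − (c−u) log (c−u)) ≤ μ c
  have hent := entropy_crude (u := (u : ℝ)) (c := (c : ℝ)) (by linarith only [huR]) (by exact_mod_cast huc)
  have hw₁ := mul_le_mul_of_nonneg_left hmax₁ (show (0 : ℝ) ≤ u by positivity)
  have hw₂ := mul_le_mul_of_nonneg_left hmax₂ hcu0.le
  rw [hcuR] at hw₂
  have e₁ : (u : ℝ) * ((Real.log m₁ - Real.log (u.factorial : ℕ)) / u + μ * Real.log u) =
      Real.log m₁ - Real.log (u.factorial : ℕ) + μ * (u * Real.log u) := by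
    field_simp
  have e₂ : ((c : ℝ) - u) * ((Real.log m₂ - Real.log ((c - u).factorial : ℕ)) / ((c : ℝ) - u) +
        μ * Real.log ((c : ℝ) - u)) =
      Real.log m₂ - Real.log ((c - u).factorial : ℕ) + μ * (((c : ℝ) - u) * Real.log ((c : ℝ) - u)) := by
    field_simp
  have e₃ : (u : ℝ) * (L / c + μ * Real.log c) + ((c : ℝ) - u) * (L / c + μ * Real.log c) =
      L + μ * ((c : ℝ) * Real.log c) := by
    field_simp; ring
  rw [e₁] at hw₁
  rw [e₂] at hw₂
  have hsum : Real.log m₁ - Real.log (u.factorial : ℕ) + μ * (u * Real.log u) +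
      (Real.log m₂ - Real.log ((c - u).factorial : ℕ) + μ * (((c : ℝ) - u) * Real.log ((c : ℝ) - u))) ≤
      L + μ * ((c : ℝ) * Real.log c) := by rw [← e₃]; linarith only [hw₁, hw₂]
  -- combine: L = log m − log c! = log m − log C(c,u) − log u! − log(c−u)!
  have hineq : Real.log (c.choose u : ℕ) - Real.log (ν.choose u : ℕ) ≤ μ * c := by
    have hμent := mul_le_mul_of_nonneg_left hent hμ0.le
    rw [mul_sub, mul_sub] at hμent
    rw [hL, hfact] at hsum
    linarith only [hsum, hsplitR, hμent]
  -- (6) numbers: (c/(8K)) log 2 ≤ (c/(2048K²))(log(4096K²)+1) + c/(32K) is impossible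
  have hl2 : (0.6931471803 : ℝ) < Real.log 2 := Real.log_two_gt_d9
  have hl2' : Real.log 2 < 0.6931471808 := Real.log_two_lt_d9
  have hlogK : Real.log K ≤ (K : ℝ) - 1 := Real.log_le_sub_one_of_pos (by positivity)
  have hlog4096 : Real.log (4096 * (K : ℝ) ^ 2) = 12 * Real.log 2 + 2 * Real.log K := by
    rw [Real.log_mul (by norm_num) (by positivity), Real.log_pow,
      show (4096 : ℝ) = 2 ^ 12 by norm_num, Real.log_pow]
    push_cast; ring
  have hμc : μ * c = (c : ℝ) / (32 * K) := by rw [hμ]; ring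
  rw [hμc] at hineq
  rw [hlog4096] at hcost
  have hfinal : (c : ℝ) / (8 * K) * Real.log 2 ≤
      (c : ℝ) / (2048 * (K : ℝ) ^ 2) * (12 * Real.log 2 + 2 * Real.log K + 1) + (c : ℝ) / (32 * K) := by
    linarith only [hgain, hcost, hineq]
  -- scale by x := c/(2048K²) > 0
  set x := (c : ℝ) / (2048 * (K : ℝ) ^ 2) with hxdef
  have hxpos : 0 < x := by rw [hxdef]; positivity
  have e1 : (c : ℝ) / (8 * K) = 256 * K * x := by rw [hxdef]; field_simp; ring
  have e2 : (c : ℝ) / (32 * K) = 64 * K * x := by rw [hxdef]; field_simp; ring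
  rw [e1, e2] at hfinal
  have hbr : 0 < 256 * (K : ℝ) * Real.log 2 - (12 * Real.log 2 + 2 * Real.log K + 1) - 64 * K := by
    nlinarith only [hl2, hl2', hlogK, hKR, mul_nonneg (sub_nonneg.2 hKR) (sub_nonneg.2 hl2.le)]
  nlinarith only [hfinal, mul_pos hxpos hbr]

end Summit.ValiantsHypothesis.ValiantsHypothesis.Theorems.DivisionGap.PerMultiplesHard.RichPieceArith
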